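import Literature.AlgebraicGeometry.Motives.TopFormCocycleUnitAtPair
import Literature.AlgebraicGeometry.Motives.ProductChartStalks
import Literature.AlgebraicGeometry.Motives.FunctionFieldProductRelativeBasis
import Literature.AlgebraicGeometry.Motives.RatFnSpec
import Literature.AlgebraicGeometry.Smoothening.SmoothAffineChartKaehlerBasis
import Literature.RingTheory.Localization.KaehlerBaseLocalization
import Literature.NumberTheory.EllipticCurves.NeronModel
import HarnessLib

/-!
# The shear cocycle of an invariant top form is a unit at every point of the generic fibre

Road W of the cell hodgecm-mathlib's r₀ programme — the (W0) core (B-p18's `W0-CORE-SPEC` §4), leaf L4c′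
«the shear identity in `K(Y)`», its FIRST half (the seam agreed with B-p12, who proves constancy +
evaluation at `(ε, ε)`): for a model `𝒳 → Spec R` (integral, with `Y := 𝒳 ×_R 𝒳` integral), a rational map
`Φ = (pr₁, m) : D ⇢ Y` defined on an open `D` containing the generic fibre `U₀` of `Y`, inducing ISOMORPHISMS of
local rings at the points of `U₀` (the shear of a birational group law), with induced endomorphism `σ` of
`K(Y)`, and a rational top form `θ = (f₀, y)` on `𝒳` over `R` which is a frame at every point of the generic
fibre of `𝒳` (the invariant form), the cocycle of `pr₂^*θ` under `Φ`,
`c = σ(pr₂♯ f₀) · B₂.det (d_{K(𝒳)} σ(pr₂♯ yᵢ))ᵢ · (pr₂♯ f₀)⁻¹ ∈ K(Y)` (`B₂ = d_{K(𝒳)} (pr₂♯ yᵢ)` the relative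
basis, `K(𝒳) → K(Y) := pr₁♯`), is a UNIT AT EVERY POINT `q ∈ U₀`.  The group law itself does not enter:
only the isomorphism property at `U₀` (hypothesis `hiso`).

Proof (Bosch–Lütkebohmert–Raynaud §4.3, the local step of the `ω`-argument): charts `V₁ ∋ pr₁ q`,
`V₂ ∋ pr₂ q`, `V₃ ∋ pr₂ (Φ q)` with exact Kähler bases (★ `Smoothening.exists_affineChart_basis_eq_D`);
base ring `A := Γ(𝒳, V₁)` acting on `𝒪_{Y,q}`, `𝒪_{Y,Φ q}` through `pr₁` (`pr₁ ∘ Φ = pr₁`) and on `K(Y)`,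
`K(D)`; relative local coordinates at `q` and `Φ q` from the product chart (★ `exists_localCoordinates_stalk_tensorObj`);
the frames of `pr₂^*θ` at `q`, `Φ q` from `hθ` at `pr₂ q`, `pr₂ (Φ q)` (germs of the chart coordinates are local
coordinates over `R`: ★ `exists_basis_kaehler_localization_eq_D` + `IsAffineOpen.isLocalization_stalk`), pulled
back along `pr₂` (`IsUnitAt.functionFieldMap`) and rewritten by the chain rule ★ `det_D_ringHom_eq` along
`pr₂♯` over `R → A`; the base switch `Γ(V₁) → K(𝒳)` for `B₂` (★ `kaehlerDifferentialEquivOfIsLocalization`);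
then ★ `isUnitAt_cocycle_of_isIso_stalkMap_pair` at `(Y′ := D, ι := D ↪ Y, Φ)` and back to `Y` along the open
immersion (★ `RatFn.isUnitAt_iff_of_flat`), reading `ι♯ ∘ σ = Φ♯`.  THEOREMS ONLY.
[cite: BLRNeronModels1990, §4.3 (Prop. 2, proof)] [cite: EdixhovenRomagny2012, Thm. 6.3 (proof)]

## Sources
* S. Bosch, W. Lütkebohmert, M. Raynaud, *Néron Models*, Springer 1990, §4.3 (proof of Prop. 2), §2.1 Prop. 3,
  §2.2 Prop. 11.
* B. Edixhoven, M. Romagny, *Group schemes out of birational group laws, Néron models*, arXiv:1204.1799v2, Thm. 6.3.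
* Tree: `Motives/TopFormCocycleUnitAtPair.lean`, `Motives/ProductChartStalks.lean`, `Motives/RelativeLocalCoordinates.lean`,
  `Motives/FunctionFieldProductRelativeBasis.lean`, `Motives/RatFnSpec.lean`, `Smoothening/SmoothAffineChartKaehlerBasis.lean`,
  `RingTheory/Localization/KaehlerBaseLocalization.lean`; cell file `B-provers/B-p18/W0CoreStubsV2.B-p18g7.lean` (`stub_L4c'`).
-/

noncomputable section

universe u

open CategoryTheory Limits AlgebraicGeometry Opposite MonoidalCategory CartesianMonoidalCategory

namespace Literature.AlgebraicGeometry.Motives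

open RatFn Literature.RingTheory.Derivation Literature.AlgebraicGeometry.Smoothening
open Literature.NumberTheory.EllipticCurves

variable {R : Type u} [CommRing R] (K : Type u) [Field K] [Algebra R K] [IsOpenImmersion (specGenericPoint R K)]
  (𝒳 : Over (Spec (.of R))) [IsIntegral 𝒳.left] [IsIntegral (𝒳 ⊗ 𝒳).left]
  [IsDominant (fst 𝒳 𝒳).left] [IsDominant (snd 𝒳 𝒳).left] (n : ℕ) [SmoothOfRelativeDimension n 𝒳.hom]
  [Algebra R 𝒳.left.functionField] [Algebra 𝒳.left.functionField (𝒳 ⊗ 𝒳).left.functionField]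

/-- **The shear cocycle of the invariant form is a unit at every point of the generic fibre** (the (W0) core's
leaf L4c′, first half).  Setting: `𝒳 → Spec R` with `𝒳`, `𝒳 ×_R 𝒳` integral and `pr₁`, `pr₂` dominant, of relative
dimension `n` (charts); `K(𝒳)` an `R`-algebra through the generic stalk (`hRK`) and `K(𝒳) → K(𝒳 ×_R 𝒳) := pr₁♯`
(`hLM`); `D ⊇ U₀` an open with a dominant `ΦD : D → 𝒳 ×_R 𝒳` over `pr₁` (`hΦ₁`) inducing isomorphisms of local
rings at the points of the generic fibre (`hiso`), `σ` its action on `K(𝒳 ×_R 𝒳)` (`hσ`); `θ = (f₀, y)` a rational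
top form on `𝒳` over `R` (`B₀ = d yᵢ`) which is a frame at every point of the generic fibre for every system of
local coordinates (`hθ`, the shape of the (W0) stub L4a′); `B₂ = d_{K(𝒳)} (pr₂♯ yᵢ)` (C5′).  Conclusion: at every
`q` over the generic point, `σ(pr₂♯ f₀) · B₂.det (d σ(pr₂♯ yᵢ))ᵢ · (pr₂♯ f₀)⁻¹` is a unit at `q`.
[cite: BLRNeronModels1990, §4.3 (Prop. 2, proof)] [cite: EdixhovenRomagny2012, Thm. 6.3 (proof)] -/
theorem isUnitAt_shearCocycle_of_mem_genericFibre
    (hRK : algebraMap R 𝒳.left.functionField = stalkHom 𝒳 (genericPoint 𝒳.left))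
    (hLM : algebraMap 𝒳.left.functionField (𝒳 ⊗ 𝒳).left.functionField =
      functionFieldMap (fst 𝒳 𝒳).left)
    (D : (𝒳 ⊗ 𝒳).left.Opens) [Nonempty D] [IsDominant D.ι]
    (hD : (𝒳 ⊗ 𝒳).hom ⁻¹ᵁ (specGenericPoint R K).opensRange ≤ D)
    (ΦD : (D : Scheme.{u}) ⟶ (𝒳 ⊗ 𝒳).left) [IsDominant ΦD]
    (hΦ₁ : ΦD ≫ (fst 𝒳 𝒳).left = D.ι ≫ (fst 𝒳 𝒳).left)
    (hiso : ∀ qD : ↥(D : Scheme.{u}),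
      (𝒳 ⊗ 𝒳).hom.base (D.ι.base qD) ∈ Set.range (specGenericPoint R K).base → IsIso (ΦD.stalkMap qD))
    (σ : (𝒳 ⊗ 𝒳).left.functionField →+* (𝒳 ⊗ 𝒳).left.functionField)
    (hσ : (functionFieldMap D.ι).comp σ = functionFieldMap ΦD)
    -- the top form `θ = (f₀, y)` on `𝒳`, a frame at every point of the generic fibre
    (f₀ : 𝒳.left.functionField) (y : Fin n → 𝒳.left.functionField)
    (B₀ : Module.Basis (Fin n) 𝒳.left.functionField Ω[𝒳.left.functionField⁄R])
    (hB₀ : ∀ i, B₀ i = KaehlerDifferential.D R _ (y i))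
    (hθ : ∀ (p : 𝒳.left) (_ : 𝒳.hom.base p ∈ Set.range (specGenericPoint R K).base)
        (z : Fin n → 𝒳.left.presheaf.stalk p)
        (b : letI := (stalkHom 𝒳 p).toAlgebra
          Module.Basis (Fin n) (𝒳.left.presheaf.stalk p) Ω[𝒳.left.presheaf.stalk p⁄R])
        (_ : letI := (stalkHom 𝒳 p).toAlgebra; ∀ i, b i = KaehlerDifferential.D R _ (z i))
        (B : Module.Basis (Fin n) 𝒳.left.functionField Ω[𝒳.left.functionField⁄R])
        (_ : ∀ i, B i = KaehlerDifferential.D R _ (toFunctionField p (z i))),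
        IsUnitAt p (f₀ * B.det B₀))
    -- the relative basis `B₂ = d_{K(𝒳)} (pr₂♯ yᵢ)` (C5′)
    (B₂ : Module.Basis (Fin n) (𝒳 ⊗ 𝒳).left.functionField
        Ω[(𝒳 ⊗ 𝒳).left.functionField⁄𝒳.left.functionField])
    (hB₂ : ∀ i, B₂ i = KaehlerDifferential.D 𝒳.left.functionField _
        (functionFieldMap (snd 𝒳 𝒳).left (y i)))
    (q : ↥(𝒳 ⊗ 𝒳).left) (hq : (𝒳 ⊗ 𝒳).hom.base q ∈ Set.range (specGenericPoint R K).base) :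
    IsUnitAt q (σ (functionFieldMap (snd 𝒳 𝒳).left f₀) *
      B₂.det (fun i => KaehlerDifferential.D 𝒳.left.functionField _
        (σ (functionFieldMap (snd 𝒳 𝒳).left (y i)))) *
      (functionFieldMap (snd 𝒳 𝒳).left f₀)⁻¹) := by
  classical
  have hY₁ : (fst 𝒳 𝒳).left ≫ 𝒳.hom = (𝒳 ⊗ 𝒳).hom := Over.w _
  have hY₂ : (snd 𝒳 𝒳).left ≫ 𝒳.hom = (𝒳 ⊗ 𝒳).hom := Over.w _
  -- `q` as a point of `D`
  obtain ⟨qD, rfl⟩ : ∃ qD : ↥(D : Scheme.{u}), D.ι.base qD = q := ⟨⟨q, hD hq⟩, rfl⟩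
  haveI : IsIso (ΦD.stalkMap qD) := hiso qD hq
  -- ### points: `Q := ι qD` (= q), `Q' := ΦD qD`; their projections
  have hΦY : ΦD ≫ (𝒳 ⊗ 𝒳).hom = D.ι ≫ (𝒳 ⊗ 𝒳).hom := by
    rw [← hY₁, ← Category.assoc, hΦ₁, Category.assoc]
  have hQ'₁ : (fst 𝒳 𝒳).left.base (ΦD.base qD) = (fst 𝒳 𝒳).left.base (D.ι.base qD) := by
    have h := congrArg (fun φ => φ.base qD) hΦ₁
    simpa only [Scheme.Hom.comp_base, TopCat.comp_app] using h
  have hq' : (𝒳 ⊗ 𝒳).hom.base (ΦD.base qD) ∈ Set.range (specGenericPoint R K).base := by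
    have h := congrArg (fun φ => φ.base qD) hΦY
    simp only [Scheme.Hom.comp_base, TopCat.comp_app] at h
    rw [h]; exact hq
  have hp : 𝒳.hom.base ((snd 𝒳 𝒳).left.base (D.ι.base qD)) ∈ Set.range (specGenericPoint R K).base := by
    have h := congrArg (fun φ => φ.base (D.ι.base qD)) hY₂
    simp only [Scheme.Hom.comp_base, TopCat.comp_app] at h
    rw [h]; exact hq
  have hp' : 𝒳.hom.base ((snd 𝒳 𝒳).left.base (ΦD.base qD)) ∈ Set.range (specGenericPoint R K).base := by
    have h := congrArg (fun φ => φ.base (ΦD.base qD)) hY₂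
    simp only [Scheme.Hom.comp_base, TopCat.comp_app] at h
    rw [h]; exact hq'
  -- ### charts (★ C1): `V₁ ∋ pr₁ Q`, `V₂ ∋ pr₂ Q`, `V₃ ∋ pr₂ Q'`
  obtain ⟨V₁, hV₁, h₁V, -, -⟩ := exists_affineChart_basis_eq_D 𝒳.hom n ((fst 𝒳 𝒳).left.base (D.ι.base qD))
  obtain ⟨V₂, hV₂, h₂V, y₂, b₂, hb₂⟩ := exists_affineChart_basis_eq_D 𝒳.hom n ((snd 𝒳 𝒳).left.base (D.ι.base qD))
  obtain ⟨V₃, hV₃, h₃V, y₃, b₃, hb₃⟩ := exists_affineChart_basis_eq_D 𝒳.hom n ((snd 𝒳 𝒳).left.base (ΦD.base qD))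
  letI algV₁ : Algebra R Γ(𝒳.left, V₁) :=
    ((Scheme.ΓSpecIso (.of R)).inv ≫ 𝒳.hom.appLE ⊤ V₁ le_top).hom.toAlgebra
  letI algV₂ : Algebra R Γ(𝒳.left, V₂) :=
    ((Scheme.ΓSpecIso (.of R)).inv ≫ 𝒳.hom.appLE ⊤ V₂ le_top).hom.toAlgebra
  letI algV₃ : Algebra R Γ(𝒳.left, V₃) :=
    ((Scheme.ΓSpecIso (.of R)).inv ≫ 𝒳.hom.appLE ⊤ V₃ le_top).hom.toAlgebra
  haveI : Nonempty V₁ := ⟨⟨_, h₁V⟩⟩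
  haveI : Nonempty V₂ := ⟨⟨_, h₂V⟩⟩
  haveI : Nonempty V₃ := ⟨⟨_, h₃V⟩⟩
  have h₁V' : (fst 𝒳 𝒳).left.base (ΦD.base qD) ∈ V₁ := by rw [hQ'₁]; exact h₁V
  -- ### the base ring `A := Γ(𝒳, V₁)` and its actions (through `pr₁`)
  letI algAY : Algebra Γ(𝒳.left, V₁) (𝒳 ⊗ 𝒳).left.functionField :=
    ((functionFieldMap (fst 𝒳 𝒳).left).comp (algebraMap Γ(𝒳.left, V₁) 𝒳.left.functionField)).toAlgebra
  letI algAD : Algebra Γ(𝒳.left, V₁) (D : Scheme.{u}).functionField :=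
    ((functionFieldMap D.ι).comp (algebraMap Γ(𝒳.left, V₁) (𝒳 ⊗ 𝒳).left.functionField)).toAlgebra
  letI algAQ : Algebra Γ(𝒳.left, V₁) ((𝒳 ⊗ 𝒳).left.presheaf.stalk (D.ι.base qD)) :=
    (((fst 𝒳 𝒳).left.stalkMap (D.ι.base qD)).hom.comp
      (𝒳.left.presheaf.germ V₁ _ h₁V).hom).toAlgebra
  letI algAQ' : Algebra Γ(𝒳.left, V₁) ((𝒳 ⊗ 𝒳).left.presheaf.stalk (ΦD.base qD)) :=
    (((fst 𝒳 𝒳).left.stalkMap (ΦD.base qD)).hom.comp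
      (𝒳.left.presheaf.germ V₁ _ h₁V').hom).toAlgebra
  letI algAqD : Algebra Γ(𝒳.left, V₁) ((D : Scheme.{u}).presheaf.stalk qD) :=
    ((D.ι.stalkMap qD).hom.comp
      (algebraMap Γ(𝒳.left, V₁) ((𝒳 ⊗ 𝒳).left.presheaf.stalk (D.ι.base qD)))).toAlgebra
  haveI towQ : IsScalarTower Γ(𝒳.left, V₁) ((𝒳 ⊗ 𝒳).left.presheaf.stalk (D.ι.base qD))
      (𝒳 ⊗ 𝒳).left.functionField :=
    isScalarTower_stalk_functionField_of_algebraMap_eq (fst 𝒳 𝒳).left (D.ι.base qD) h₁V rfl rfl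
  haveI towQ' : IsScalarTower Γ(𝒳.left, V₁) ((𝒳 ⊗ 𝒳).left.presheaf.stalk (ΦD.base qD))
      (𝒳 ⊗ 𝒳).left.functionField :=
    isScalarTower_stalk_functionField_of_algebraMap_eq (fst 𝒳 𝒳).left (ΦD.base qD) h₁V' rfl rfl
  haveI towqD : IsScalarTower Γ(𝒳.left, V₁) ((D : Scheme.{u}).presheaf.stalk qD)
      (D : Scheme.{u}).functionField := by
    refine IsScalarTower.of_algebraMap_eq fun a => ?_
    change functionFieldMap D.ι (algebraMap Γ(𝒳.left, V₁) (𝒳 ⊗ 𝒳).left.functionField a) =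
      toFunctionField qD (D.ι.stalkMap qD (algebraMap Γ(𝒳.left, V₁) _ a))
    rw [IsScalarTower.algebraMap_apply Γ(𝒳.left, V₁) ((𝒳 ⊗ 𝒳).left.presheaf.stalk (D.ι.base qD))
      (𝒳 ⊗ 𝒳).left.functionField a, functionFieldMap_toFunctionField]
  -- compatibilities of the `A`-structures with `ι = D.ι` and `Φ = ΦD`
  have hAι : (D.ι.stalkMap qD).hom.comp
      (algebraMap Γ(𝒳.left, V₁) ((𝒳 ⊗ 𝒳).left.presheaf.stalk (D.ι.base qD))) =
      algebraMap Γ(𝒳.left, V₁) ((D : Scheme.{u}).presheaf.stalk qD) := rfl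
  have hιA : (functionFieldMap D.ι).comp (algebraMap Γ(𝒳.left, V₁) (𝒳 ⊗ 𝒳).left.functionField) =
      algebraMap Γ(𝒳.left, V₁) (D : Scheme.{u}).functionField := rfl
  have hAΦ : (ΦD.stalkMap qD).hom.comp
      (algebraMap Γ(𝒳.left, V₁) ((𝒳 ⊗ 𝒳).left.presheaf.stalk (ΦD.base qD))) =
      algebraMap Γ(𝒳.left, V₁) ((D : Scheme.{u}).presheaf.stalk qD) := by
    -- both sides are `a ↦ germ_{qD} ((g)^* a)` for `g = ΦD ≫ pr₁ = ι ≫ pr₁`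
    have hgen : ∀ (g₁ g₂ : (D : Scheme.{u}) ⟶ 𝒳.left) (_ : g₁ = g₂) (h₁ : g₁.base qD ∈ V₁)
        (h₂ : g₂.base qD ∈ V₁) (a : Γ(𝒳.left, V₁)),
        (D : Scheme.{u}).presheaf.germ (g₁ ⁻¹ᵁ V₁) qD h₁ (g₁.app V₁ a) =
          (D : Scheme.{u}).presheaf.germ (g₂ ⁻¹ᵁ V₁) qD h₂ (g₂.app V₁ a) := by
      rintro g₁ _ rfl h₁ h₂ a; rfl
    have hm₁ : (ΦD ≫ (fst 𝒳 𝒳).left).base qD ∈ V₁ := by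
      rw [Scheme.Hom.comp_base, TopCat.comp_app]; exact h₁V'
    have hm₂ : (D.ι ≫ (fst 𝒳 𝒳).left).base qD ∈ V₁ := by
      rw [Scheme.Hom.comp_base, TopCat.comp_app]; exact h₁V
    ext a
    change ΦD.stalkMap qD (((fst 𝒳 𝒳).left.stalkMap (ΦD.base qD))
        (𝒳.left.presheaf.germ V₁ _ h₁V' a)) =
      D.ι.stalkMap qD (((fst 𝒳 𝒳).left.stalkMap (D.ι.base qD)) (𝒳.left.presheaf.germ V₁ _ h₁V a))
    rw [Scheme.Hom.germ_stalkMap_apply, Scheme.Hom.germ_stalkMap_apply,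
      Scheme.Hom.germ_stalkMap_apply, Scheme.Hom.germ_stalkMap_apply]
    have e := hgen _ _ hΦ₁ hm₁ hm₂ a
    simp only [Scheme.Hom.comp_app] at e
    exact e
  have hΦA : (functionFieldMap ΦD).comp (algebraMap Γ(𝒳.left, V₁) (𝒳 ⊗ 𝒳).left.functionField) =
      algebraMap Γ(𝒳.left, V₁) (D : Scheme.{u}).functionField := by
    have e3 : functionFieldMap (ΦD ≫ (fst 𝒳 𝒳).left) = functionFieldMap (D.ι ≫ (fst 𝒳 𝒳).left) := by
      congr 1
    change (functionFieldMap ΦD).comp ((functionFieldMap (fst 𝒳 𝒳).left).comp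
        (algebraMap Γ(𝒳.left, V₁) 𝒳.left.functionField)) =
      (functionFieldMap D.ι).comp ((functionFieldMap (fst 𝒳 𝒳).left).comp
        (algebraMap Γ(𝒳.left, V₁) 𝒳.left.functionField))
    rw [← RingHom.comp_assoc, ← RingHom.comp_assoc, ← functionFieldMap_comp (fst 𝒳 𝒳).left ΦD,
      ← functionFieldMap_comp (fst 𝒳 𝒳).left D.ι, e3]
  -- ### relative coordinates at `Q` and `Q'` (★ PCS-R) and their function-field bases
  obtain ⟨w, b, hb, hw⟩ := exists_localCoordinates_stalk_tensorObj 𝒳 𝒳 hV₁ hV₂ rfl rfl b₂ hb₂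
    (D.ι.base qD) h₁V h₂V rfl
  obtain ⟨w', b', hb', hw'⟩ := exists_localCoordinates_stalk_tensorObj 𝒳 𝒳 hV₁ hV₃ rfl rfl b₃ hb₃
    (ΦD.base qD) h₁V' h₃V rfl
  obtain ⟨W₁, hW₁⟩ := exists_basis_functionField_of_localCoordinates' n Γ(𝒳.left, V₁) b hb
  obtain ⟨W', hW'⟩ := exists_basis_functionField_of_localCoordinates' n Γ(𝒳.left, V₁) b' hb'
  -- ### the top form over `A`: `B = d_A (pr₂♯ yᵢ)` from `B₂` (base switch `Γ(V₁) → K(𝒳)`, a localisation)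
  haveI towAXY : IsScalarTower Γ(𝒳.left, V₁) 𝒳.left.functionField (𝒳 ⊗ 𝒳).left.functionField :=
    IsScalarTower.of_algebraMap_eq fun a => by rw [hLM]; rfl
  haveI : IsFractionRing Γ(𝒳.left, V₁) 𝒳.left.functionField :=
    functionField_isFractionRing_of_isAffineOpen 𝒳.left V₁ hV₁
  let eΩ := Literature.RingTheory.Localization.kaehlerDifferentialEquivOfIsLocalization Γ(𝒳.left, V₁)
    𝒳.left.functionField (𝒳 ⊗ 𝒳).left.functionField (nonZeroDivisors Γ(𝒳.left, V₁))
  let B : Module.Basis (Fin n) (𝒳 ⊗ 𝒳).left.functionField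
      Ω[(𝒳 ⊗ 𝒳).left.functionField⁄Γ(𝒳.left, V₁)] := B₂.map eΩ.symm
  have hB : ∀ i, B i = KaehlerDifferential.D Γ(𝒳.left, V₁) _ (functionFieldMap (snd 𝒳 𝒳).left (y i)) := by
    intro i
    change eΩ.symm (B₂ i) = _
    rw [hB₂, LinearEquiv.symm_apply_eq,
      Literature.RingTheory.Localization.kaehlerDifferentialEquivOfIsLocalization_D]
  -- ### the frames at `Q` and at `Q'` (from `hθ` at `pr₂ Q`, `pr₂ Q'` by the chain rule along `pr₂♯`)
  -- `R → Γ(V₁) → K(𝒳)` is `R → K(𝒳)`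
  have hRV₁ : (algebraMap Γ(𝒳.left, V₁) 𝒳.left.functionField).comp (algebraMap R Γ(𝒳.left, V₁)) =
      algebraMap R 𝒳.left.functionField := by
    ext r
    rw [hRK]
    change 𝒳.left.presheaf.germ V₁ (genericPoint 𝒳.left) _
        (((Scheme.ΓSpecIso (.of R)).inv ≫ 𝒳.hom.appLE ⊤ V₁ le_top) r) = _
    simp only [Scheme.Hom.appLE, CommRingCat.hom_comp, stalkHom, globalHom, RingHom.coe_comp,
      Function.comp_apply]
    rw [TopCat.Presheaf.germ_res_apply 𝒳.left.presheaf]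
    rfl
  -- `pr₂♯ ∘ (R → K(𝒳)) = (Γ(V₁) → K(Y)) ∘ (R → Γ(V₁))`: both are `R → K(Y)`
  have hστ : (functionFieldMap (snd 𝒳 𝒳).left).comp (algebraMap R 𝒳.left.functionField) =
      (algebraMap Γ(𝒳.left, V₁) (𝒳 ⊗ 𝒳).left.functionField).comp (algebraMap R Γ(𝒳.left, V₁)) := by
    change _ = ((functionFieldMap (fst 𝒳 𝒳).left).comp
      (algebraMap Γ(𝒳.left, V₁) 𝒳.left.functionField)).comp (algebraMap R Γ(𝒳.left, V₁))
    rw [RingHom.comp_assoc, hRV₁, hRK, functionFieldMap_comp_stalkHom (snd 𝒳 𝒳),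
      functionFieldMap_comp_stalkHom (fst 𝒳 𝒳)]
  have hBfun : (fun j => KaehlerDifferential.D Γ(𝒳.left, V₁) (𝒳 ⊗ 𝒳).left.functionField
      (functionFieldMap (snd 𝒳 𝒳).left (y j))) = ⇑B := funext fun j => (hB j).symm
  have hB₀fun : (fun j => KaehlerDifferential.D R 𝒳.left.functionField (y j)) = ⇑B₀ :=
    funext fun j => (hB₀ j).symm
  -- the frame transfer, once for both points
  have hframe : ∀ {Q₀ : ↥(𝒳 ⊗ 𝒳).left}
      (_ : (𝒳 ⊗ 𝒳).hom.base Q₀ ∈ Set.range (specGenericPoint R K).base)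
      {V : 𝒳.left.Opens} (hV : IsAffineOpen V) (hQ₀V : (snd 𝒳 𝒳).left.base Q₀ ∈ V)
      [Algebra R Γ(𝒳.left, V)]
      (_ : algebraMap R Γ(𝒳.left, V) = ((Scheme.ΓSpecIso (.of R)).inv ≫ 𝒳.hom.appLE ⊤ V le_top).hom)
      {yV : Fin n → Γ(𝒳.left, V)} (bV : Module.Basis (Fin n) Γ(𝒳.left, V) Ω[Γ(𝒳.left, V)⁄R])
      (_ : ∀ i, bV i = KaehlerDifferential.D R _ (yV i)) [Nonempty V]
      [Algebra Γ(𝒳.left, V₁) ((𝒳 ⊗ 𝒳).left.presheaf.stalk Q₀)]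
      [IsScalarTower Γ(𝒳.left, V₁) ((𝒳 ⊗ 𝒳).left.presheaf.stalk Q₀) (𝒳 ⊗ 𝒳).left.functionField]
      {wQ : Fin n → (𝒳 ⊗ 𝒳).left.presheaf.stalk Q₀}
      (_ : ∀ i, toFunctionField Q₀ (wQ i) =
        functionFieldMap (snd 𝒳 𝒳).left (algebraMap Γ(𝒳.left, V) 𝒳.left.functionField (yV i)))
      (WQ : Module.Basis (Fin n) (𝒳 ⊗ 𝒳).left.functionField
        Ω[(𝒳 ⊗ 𝒳).left.functionField⁄Γ(𝒳.left, V₁)])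
      (_ : ∀ i, WQ i = KaehlerDifferential.D Γ(𝒳.left, V₁) _ (toFunctionField Q₀ (wQ i))),
      IsUnitAt Q₀ (functionFieldMap (snd 𝒳 𝒳).left f₀ * WQ.det B) := by
    intro Q₀ hQ₀ V hV hQ₀V _ halgV yV bV hbV _ _ _ wQ hwQ WQ hWQ
    -- the point `p := pr₂ Q₀` of `𝒳`, over the generic point
    have hpgen : 𝒳.hom.base ((snd 𝒳 𝒳).left.base Q₀) ∈ Set.range (specGenericPoint R K).base := by
      have h := congrArg (fun φ => φ.base Q₀) hY₂
      simp only [Scheme.Hom.comp_base, TopCat.comp_app] at h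
      rw [h]; exact hQ₀
    -- the local ring at `p` as an `R`- and a `Γ(V)`-algebra (germs), a localisation of `Γ(V)`
    letI algVp : Algebra Γ(𝒳.left, V) (𝒳.left.presheaf.stalk ((snd 𝒳 𝒳).left.base Q₀)) :=
      TopCat.Presheaf.algebra_section_stalk 𝒳.left.presheaf (⟨_, hQ₀V⟩ : V)
    letI algRp : Algebra R (𝒳.left.presheaf.stalk ((snd 𝒳 𝒳).left.base Q₀)) :=
      (stalkHom 𝒳 ((snd 𝒳 𝒳).left.base Q₀)).toAlgebra
    haveI towRVp : IsScalarTower R Γ(𝒳.left, V) (𝒳.left.presheaf.stalk ((snd 𝒳 𝒳).left.base Q₀)) := by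
      refine IsScalarTower.of_algebraMap_eq fun r => ?_
      rw [halgV]
      change stalkHom 𝒳 _ r = 𝒳.left.presheaf.germ V _ hQ₀V
        (((Scheme.ΓSpecIso (.of R)).inv ≫ 𝒳.hom.appLE ⊤ V le_top) r)
      simp only [Scheme.Hom.appLE, CommRingCat.hom_comp, stalkHom, globalHom, RingHom.coe_comp,
        Function.comp_apply]
      rw [TopCat.Presheaf.germ_res_apply 𝒳.left.presheaf]
      rfl
    haveI : IsLocalization.AtPrime (𝒳.left.presheaf.stalk ((snd 𝒳 𝒳).left.base Q₀))
        (hV.primeIdealOf (⟨_, hQ₀V⟩ : V)).asIdeal := hV.isLocalization_stalk ⟨_, hQ₀V⟩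
    -- local coordinates at `p` over `R`: the germs of the chart coordinates
    obtain ⟨bz, hbz⟩ := exists_basis_kaehler_localization_eq_D
      (𝒳.left.presheaf.stalk ((snd 𝒳 𝒳).left.base Q₀))
      (hV.primeIdealOf (⟨_, hQ₀V⟩ : V)).asIdeal.primeCompl bV hbV
    -- the scalar tower `R → 𝒪_p → K(𝒳)`
    haveI towRpK : IsScalarTower R (𝒳.left.presheaf.stalk ((snd 𝒳 𝒳).left.base Q₀))
        𝒳.left.functionField := by
      refine IsScalarTower.of_algebraMap_eq fun r => ?_
      rw [hRK]
      change _ = toFunctionField _ (stalkHom 𝒳 _ r)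
      simp only [stalkHom, globalHom, RingHom.coe_comp, Function.comp_apply]
      rw [toFunctionField_germ]
    obtain ⟨Bp, hBp⟩ := exists_basis_functionField_of_localCoordinates' n R bz hbz
    -- `θ` is a frame at `p`
    have hθp := hθ ((snd 𝒳 𝒳).left.base Q₀) hpgen _ bz hbz Bp hBp
    -- pull back along `pr₂` and rewrite the determinant by the chain rule
    have hpull := hθp.functionFieldMap (f := (snd 𝒳 𝒳).left) (x' := Q₀)
    rw [map_mul] at hpull
    have hWQ' : ∀ i, WQ i = KaehlerDifferential.D Γ(𝒳.left, V₁) _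
        (functionFieldMap (snd 𝒳 𝒳).left (toFunctionField ((snd 𝒳 𝒳).left.base Q₀)
          (algebraMap Γ(𝒳.left, V) _ (yV i)))) := fun i => by
      have e := toFunctionField_algebraMap_stalk (V := V) (⟨_, hQ₀V⟩ : V) (yV i)
      rw [hWQ, hwQ, ← e]
    have hchain := det_D_ringHom_eq (algebraMap R Γ(𝒳.left, V₁)) (functionFieldMap (snd 𝒳 𝒳).left)
      hστ Bp hBp WQ hWQ' y
    rw [hB₀fun, hBfun] at hchain
    rw [← hchain] at hpull
    exact hpull
  have hq₁ : IsUnitAt (D.ι.base qD) (functionFieldMap (snd 𝒳 𝒳).left f₀ * W₁.det B) :=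
    hframe hq hV₂ h₂V rfl b₂ hb₂ hw W₁ hW₁
  have hq₂ : IsUnitAt (ΦD.base qD) (functionFieldMap (snd 𝒳 𝒳).left f₀ * W'.det B) :=
    hframe hq' hV₃ h₃V rfl b₃ hb₃ hw' W' hW'
  -- ### the basis `C = d_A (ι♯ pr₂♯ yᵢ)` on `K(D)` and F1
  obtain ⟨C, hC⟩ := exists_basis_of_bijective_eq_D (functionFieldMap D.ι)
    (functionFieldMap_bijective_of_isOpenImmersion D.ι) hιA B hB
  have key := isUnitAt_cocycle_of_isIso_stalkMap_pair ΦD D.ι n Γ(𝒳.left, V₁) qD hAΦ hAι hΦA hιA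
    b hb W₁ hW₁ b' hb' W' hW' (functionFieldMap (snd 𝒳 𝒳).left f₀) B hB hq₁ hq₂ C hC
  -- ### back to `Y` along the open immersion `ι`: `ι♯ c` is the element of `key`
  rw [isUnitAt_iff_of_flat D.ι qD]
  have hισ : ∀ x, functionFieldMap D.ι (σ x) = functionFieldMap ΦD x := fun x => RingHom.congr_fun hσ x
  -- base switch `Γ(V₁) → K(𝒳)` for the determinant, then the chain rule along `ι♯`
  have hτK : (RingHom.id (𝒳 ⊗ 𝒳).left.functionField).comp
      (algebraMap Γ(𝒳.left, V₁) (𝒳 ⊗ 𝒳).left.functionField) =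
      (algebraMap 𝒳.left.functionField (𝒳 ⊗ 𝒳).left.functionField).comp
        (algebraMap Γ(𝒳.left, V₁) 𝒳.left.functionField) := by
    rw [RingHom.id_comp, ← IsScalarTower.algebraMap_eq]
  have hB₂' : ∀ i, B₂ i = KaehlerDifferential.D 𝒳.left.functionField _
      (RingHom.id _ (functionFieldMap (snd 𝒳 𝒳).left (y i))) := fun i => by
    rw [hB₂, RingHom.id_apply]
  have hdet₁ : B₂.det (fun i => KaehlerDifferential.D 𝒳.left.functionField _
      (σ (functionFieldMap (snd 𝒳 𝒳).left (y i)))) =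
      B.det (fun i => KaehlerDifferential.D Γ(𝒳.left, V₁) _
        (σ (functionFieldMap (snd 𝒳 𝒳).left (y i)))) := by
    have h := det_D_ringHom_eq (algebraMap Γ(𝒳.left, V₁) 𝒳.left.functionField) (RingHom.id _)
      hτK B hB B₂ hB₂' (fun i => σ (functionFieldMap (snd 𝒳 𝒳).left (y i)))
    simpa only [RingHom.id_apply] using h
  have hdet₂ : functionFieldMap D.ι (B.det (fun i => KaehlerDifferential.D Γ(𝒳.left, V₁) _
      (σ (functionFieldMap (snd 𝒳 𝒳).left (y i))))) =
      C.det (fun i => KaehlerDifferential.D Γ(𝒳.left, V₁) _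
        (functionFieldMap ΦD (functionFieldMap (snd 𝒳 𝒳).left (y i)))) := by
    have h := det_D_ringHom_eq (RingHom.id Γ(𝒳.left, V₁)) (functionFieldMap D.ι)
      (by rw [hιA, RingHom.comp_id]) B hB C hC (fun i => σ (functionFieldMap (snd 𝒳 𝒳).left (y i)))
    rw [← h]
    simp only [hισ]
  rw [map_mul, map_mul, map_inv₀, hισ, hdet₁, hdet₂]
  exact key

end Literature.AlgebraicGeometry.Motives

end
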